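import Literature.AlgebraicGeometry.Frobenioids.PadicKummerFNLayerTransport
import HarnessLib

/-!
# Frobenioids II, Thm. 2.4 (ii): naturality of `F_N(A) → H²(Γ_E, μ_N(Ē))` along context isomorphisms
# (cell row W12, PIECE B of abc-iut-w5-d201's cut — sequel)

Mochizuki, *The geometry of Frobenioids II*, Kyushu J. Math. **62** (2008) 401–460, §2, Theorem 2.4 (ii)
p. 20 and its proof p. 21 ("the natural isomorphisms `F_N(Aᵢ) ⥲ ℤ/Nℤ` … induced on subquotients" by the
invariant of the layer field) [cite: MochizukiFrdII2008, Thm 2.4 (ii) p.21].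

Sequel of `PadicKummerFNLayerTransport.lean` (abc-iut-L2-t12 g3): for an isomorphism
`e : Iso X₁ X₂` of Galois-level contexts over `K₁`, `K₂` (abc-iut-L1-t7's `ofGalois`) with models
`mᵢ : MuModel Lᵢ Oᵢ N`, layers `Eᵢ/Kᵢ` with `Hᵢ = Gal(K̄ᵢ/ι⁻¹Eᵢ)`, ANY `β : Γ_{E₁} ≃ₜ* Γ_{E₂}` lying
over `e.isoG` (`hβ`) and ANY `ψ : Ē₁ˣ → Ē₂ˣ` whose restriction to `μ_N` matches `e.muIso` through the
models (`hψ`) and is `β`-equivariant (`hμ`):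
* `fnToH2Of_isoFN` (any contexts) — `F_N(A) ↪ H²(H, μ_N(A))` intertwines `e.isoFN` with the `H`-level
  transport `pushH` of `e.transportMu` (square `infl₂ ≫ pullH = pull ≫ infl₁` of
  `KummerInflationTransportPair.lean`);
* `Iso.pushH_two_comp_map₃` (any contexts) — `pushH ≫ (restrict, change coefficients) = (restrict, change
  coefficients) ≫ … ≫ …` whenever the group homomorphisms and the coefficient maps agree (functoriality
  `ContinuousCohomology.map_comp` + `contMap_congr`); at the layers the group homomorphisms `Γ_{E₂} → H₁`
  agree by `hβ`, the coefficient maps by `hψ`;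
* **`fnLayerMap_isoFN`** — `Θ₂ (e.isoFN x) = Prop121vii.cohTransport β (mu E₁ N) (mu E₂ N)
  (muCarrierMap ψ N) hμ 2 (Θ₁ x)`: the shape `hΘ` consumed by PIECE C (abc-iut-w5-d201's
  `Iso.thm24ii_of_layerMaps`, p420779), and `layerMuEquiv_square_of_units` deriving its `μ`-square
  hypothesis `hψ` from the units-level square that PIECE A (`Prop121vii.exists_layerTransport`) delivers.
Proof-only; nothing here concerns [IUTchIII]; classical. Universe `0`.
-/

noncomputable section

open CategoryTheory Function

namespace Literature.AlgebraicGeometry.Frobenioids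

namespace PadicKummer

namespace Def22Context

open Field IntermediateField Kummer
open Literature.NumberTheory.GaloisRepresentations
open Literature.NumberTheory.GaloisRepresentations.LocalWeilDatum
open Literature.NumberTheory.GaloisRepresentations.DiscreteGaloisModule
open Literature.AnabelianGeometry.AbsoluteAnabelian
open _root_.TopRep _root_.ContinuousCohomology

/-! ### `F_N(A) ↪ H²(H, μ_N(A))` and the `H`-level transport along a context isomorphism -/

section AnyContext

variable {X₁ X₂ : Def22Context} (e : Def22Context.Iso X₁ X₂) (N : ℕ)

/-- `fnToH2Of` on the class of `y ∈ H²(H_A, μ_N(A))` is its image in `H²(H, μ_N(A))`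
(abc-iut-L1-t4's `fnToH2_mk`, at the context's instances). [cite: MochizukiFrdII2008, Def 2.2 (ii) p.18] -/
theorem fnToH2Of_mk (X : Def22Context) (N : ℕ) (y : continuousCohomology 2 (muTopRep N X.O X.HA)) :
    fnToH2Of X N (y : FN X N) = (infl X.HA X.qHA (muTopRep N X.O X.HA) 2).hom y :=
  fnToH2_mk N X.O X.HA X.qHA y

/-- **Naturality of "restrict along `φ`, change coefficients" against the `H`-level transport `pushH`**
(any contexts; functoriality `ContinuousCohomology.map_comp` + `contMap_congr`): if the group
homomorphisms `G₂′ → H₁` agree (`hgrp`, through `e.hInv`) and the coefficient maps agree pointwise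
(`hcoef`, through the transport `fH'` of `μ_N(A₁) → μ_N(A₂)`), then
`pushH ≫ map φ₂ f₂ = map φ₁ f₁ ≫ map γ g ≫ map δ h` on `H²`. [cite: MochizukiFrdII2008, Thm 2.4 (i) p.19] -/
theorem Iso.pushH_two_comp_map₃ {G₁ G₂ G₃ : Type} [Group G₁] [TopologicalSpace G₁] [IsTopologicalGroup G₁]
    [Group G₂] [TopologicalSpace G₂] [IsTopologicalGroup G₂]
    [Group G₃] [TopologicalSpace G₃] [IsTopologicalGroup G₃]
    (φ₁ : G₁ →ₜ* X₁.H) (φ₂ : G₃ →ₜ* X₂.H) (γ : G₂ →ₜ* G₁) (δ : G₃ →ₜ* G₂)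
    {Y₁ : TopRep ℤ G₁} {Y₂ : TopRep ℤ G₂} {Y₃ : TopRep ℤ G₃}
    (f₁ : TopRep.res (φ₁ : G₁ →* X₁.H) (TopRep.res (X₁.qHA : X₁.H →* X₁.HA) (muTopRep N X₁.O X₁.HA)) ⟶ Y₁)
    (f₂ : TopRep.res (φ₂ : G₃ →* X₂.H) (TopRep.res (X₂.qHA : X₂.H →* X₂.HA) (muTopRep N X₂.O X₂.HA)) ⟶ Y₃)
    (g : TopRep.res (γ : G₂ →* G₁) Y₁ ⟶ Y₂) (h : TopRep.res (δ : G₃ →* G₂) Y₂ ⟶ Y₃)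
    (hgrp : e.hInv.comp φ₂ = (φ₁.comp γ).comp δ)
    (hcoef : ∀ x, f₂.hom ((e.transportMu N).fH'.hom x) = h.hom (g.hom (f₁.hom x))) :
    (e.transportMu N).pushH 2 ≫ ContinuousCohomology.map φ₂ f₂ 2 =
      ContinuousCohomology.map φ₁ f₁ 2 ≫ ContinuousCohomology.map γ g 2 ≫ ContinuousCohomology.map δ h 2 := by
  rw [show (e.transportMu N).pushH 2 =
      ContinuousCohomology.map (e.transportMu N).d' (e.transportMu N).fH' 2 from rfl,
    ← ContinuousCohomology.map_comp, ← ContinuousCohomology.map_comp, ← ContinuousCohomology.map_comp]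
  exact contMap_congr hgrp _ _ hcoef 2

/-- `F_N(A₁) ↪ H²(H₁, μ)` intertwines `isoFN` with the `H`-level transport `pushH` of
`e.transportMu`: `fnToH2₂ (isoFN x) = pushH (fnToH2₁ x)` (from the square `infl₂ ≫ pullH = pull ≫ infl₁`
and `pullH ≫ pushH = 𝟙`). [cite: MochizukiFrdII2008, Thm 2.4 (i) p.19] -/
theorem fnToH2Of_isoFN (x : FN X₁ N) :
    fnToH2Of X₂ N (e.isoFN N x) = ((e.transportMu N).pushH 2).hom (fnToH2Of X₁ N x) := by
  obtain ⟨y, rfl⟩ := QuotientAddGroup.mk_surjective x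
  rw [e.isoFN_mk N y, fnToH2Of_mk, fnToH2Of_mk]
  have hsq := congrArg (fun φ => φ.hom (((e.transportMu N).push 2).hom y)) ((e.transportMu N).square 2)
  simp only [TopModuleCat.hom_comp, ContinuousLinearMap.coe_comp, Function.comp_apply] at hsq
  rw [(e.transportMu N).pull_push_apply 2 y] at hsq
  -- hsq : pullH (infl₂ (push y)) = infl₁ y
  change (ContinuousCohomology.map X₂.qHA (𝟙 _) 2).hom (((e.transportMu N).push 2).hom y) =
    ((e.transportMu N).pushH 2).hom ((ContinuousCohomology.map X₁.qHA (𝟙 _) 2).hom y)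
  rw [← hsq]
  have h3 := congr_arg
    (fun φ => φ.hom ((ContinuousCohomology.map X₂.qHA (𝟙 _) 2).hom (((e.transportMu N).push 2).hom y)))
    ((e.transportMu N).pullH_pushH 2)
  simpa using h3.symm

end AnyContext

/-! ### Naturality of `Θ` along context isomorphisms -/

section Naturality

variable {K₁ K₂ : Type} [Field K₁] [Field K₂]
  {L₁ : IntermediateField K₁ (AlgebraicClosure K₁)} [Normal K₁ L₁] [FiniteDimensional K₁ L₁]
  {AutC₁ O₁ : Type} [Group AutC₁] [CommMonoid O₁] [IsCancelMul O₁] [MulDistribMulAction AutC₁ O₁]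
  [MulDistribMulAction (L₁ ≃ₐ[K₁] L₁) O₁] {H₁ : Subgroup (absoluteGaloisGroup K₁)} [H₁.Normal]
  {hH₁ : IsOpen (H₁ : Set (absoluteGaloisGroup K₁))} {res₁ : AutC₁ →* (L₁ ≃ₐ[K₁] L₁)}
  {res_smul₁ : ∀ (α : AutC₁) (x : O₁), res₁ α • x = α • x}
  {L₂ : IntermediateField K₂ (AlgebraicClosure K₂)} [Normal K₂ L₂] [FiniteDimensional K₂ L₂]
  {AutC₂ O₂ : Type} [Group AutC₂] [CommMonoid O₂] [IsCancelMul O₂] [MulDistribMulAction AutC₂ O₂]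
  [MulDistribMulAction (L₂ ≃ₐ[K₂] L₂) O₂] {H₂ : Subgroup (absoluteGaloisGroup K₂)} [H₂.Normal]
  {hH₂ : IsOpen (H₂ : Set (absoluteGaloisGroup K₂))} {res₂ : AutC₂ →* (L₂ ≃ₐ[K₂] L₂)}
  {res_smul₂ : ∀ (α : AutC₂) (x : O₂), res₂ α • x = α • x}
  (e : Iso (ofGalois L₁ H₁ hH₁ res₁ res_smul₁) (ofGalois L₂ H₂ hH₂ res₂ res_smul₂)) {N : ℕ}
  (m₁ : MuModel L₁ O₁ N) (m₂ : MuModel L₂ O₂ N)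
  (E₁ : Type) [Field E₁] [Algebra K₁ E₁] [Algebra.IsAlgebraic K₁ E₁]
  (hHE₁ : H₁ = galFixing K₁ (embField K₁ E₁))
  (E₂ : Type) [Field E₂] [Algebra K₂ E₂] [Algebra.IsAlgebraic K₂ E₂]
  (hHE₂ : H₂ = galFixing K₂ (embField K₂ E₂))
  (β : absoluteGaloisGroup E₁ ≃ₜ* absoluteGaloisGroup E₂)
  (hβ : ∀ σ : absoluteGaloisGroup E₁,
    absGaloisRestrict K₂ E₂ (β σ) = e.isoG (absGaloisRestrict K₁ E₁ σ))
  (ψ : (AlgebraicClosure E₁)ˣ →* (AlgebraicClosure E₂)ˣ)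
  (hψ : ∀ ζ : Additive (Mu N O₁),
    layerMuEquiv E₂ N (m₂.toContinuousLinearEquiv (Additive.ofMul (e.muIso N (Additive.toMul ζ)))) =
      Prop121vii.muCarrierMap ψ N (layerMuEquiv E₁ N (m₁.toContinuousLinearEquiv ζ)))
  (hμ : Prop121vii.IsEquivariantOver β (mu E₁ N) (mu E₂ N) (Prop121vii.muCarrierMap ψ N))

/-- **NATURALITY of `Θ` along a context isomorphism** (PIECE B): for layers `Eᵢ` with
`Γ_{Eᵢ} ≅ Hᵢ`, an isomorphism `β : Γ_{E₁} ⥲ Γ_{E₂}` lying over `e.isoG` (`hβ`), and a coefficient map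
`ψ|_{μ_N} : μ_N(Ē₁) → μ_N(Ē₂)` matching `e.muIso` through the models (`hψ`) and `β`-equivariant (`hμ`):
`Θ₂ ∘ isoFN = cohTransport(β, ψ|_{μ_N}) ∘ Θ₁` — the transport of [AbsAnab] Prop. 1.2.1 (vii)
(`Prop121vii.cohTransport`). [cite: MochizukiFrdII2008, Thm 2.4 (ii) p.21] -/
theorem fnLayerMap_isoFN (hβ : ∀ σ : absoluteGaloisGroup E₁,
      absGaloisRestrict K₂ E₂ (β σ) = e.isoG (absGaloisRestrict K₁ E₁ σ))
    (hψ : ∀ ζ : Additive (Mu N O₁),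
      layerMuEquiv E₂ N (m₂.toContinuousLinearEquiv (Additive.ofMul (e.muIso N (Additive.toMul ζ)))) =
        Prop121vii.muCarrierMap ψ N (layerMuEquiv E₁ N (m₁.toContinuousLinearEquiv ζ)))
    (x : FN (ofGalois L₁ H₁ hH₁ res₁ res_smul₁) N) :
    fnLayerMap L₂ H₂ hH₂ res₂ res_smul₂ E₂ hHE₂ m₂ (e.isoFN N x) =
      Prop121vii.cohTransport β (mu E₁ N) (mu E₂ N) (Prop121vii.muCarrierMap ψ N) hμ 2
        (fnLayerMap L₁ H₁ hH₁ res₁ res_smul₁ E₁ hHE₁ m₁ x) := by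
  rw [fnLayerMap_apply, fnLayerMap_apply, fnToH2Of_isoFN e N]
  -- unfold `cohTransport` into its two `ContinuousCohomology.map`s
  change _ = (ContinuousCohomology.map (ContinuousMonoidHom.id (absoluteGaloisGroup E₂))
      (X := DiscreteGaloisModule.toTopRep (ContinuousRep.restrict (mu E₁ N)
        (β.symm : absoluteGaloisGroup E₂ →ₜ* absoluteGaloisGroup E₁)))
      (Y := (mu E₂ N).toTopRep)
      (TopRep.ofHom ⟨(Prop121vii.intertwiningOfEquivariant β (mu E₁ N) (mu E₂ N)
          (Prop121vii.muCarrierMap ψ N) hμ).toContinuousLinearMap,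
        (Prop121vii.intertwiningOfEquivariant β (mu E₁ N) (mu E₂ N)
          (Prop121vii.muCarrierMap ψ N) hμ).isIntertwining'⟩) 2).hom
    ((ContinuousCohomology.map (β.symm : absoluteGaloisGroup E₂ →ₜ* absoluteGaloisGroup E₁)
      (X := (mu E₁ N).toTopRep)
      (Y := DiscreteGaloisModule.toTopRep (ContinuousRep.restrict (mu E₁ N)
        (β.symm : absoluteGaloisGroup E₂ →ₜ* absoluteGaloisGroup E₁)))
      (TopRep.ofHom ⟨ContinuousLinearMap.id ℤ (MuCarrier E₁ N), fun _ => rfl⟩) 2).hom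
      ((ContinuousCohomology.map (layerHom L₁ H₁ hH₁ res₁ res_smul₁ E₁ hHE₁)
        (layerCoeff L₁ H₁ hH₁ res₁ res_smul₁ E₁ hHE₁ m₁) 2).hom
        (fnToH2Of (ofGalois L₁ H₁ hH₁ res₁ res_smul₁) N x)))
  have key := e.pushH_two_comp_map₃ N
    (layerHom L₁ H₁ hH₁ res₁ res_smul₁ E₁ hHE₁) (layerHom L₂ H₂ hH₂ res₂ res_smul₂ E₂ hHE₂)
    (β.symm : absoluteGaloisGroup E₂ →ₜ* absoluteGaloisGroup E₁)
    (ContinuousMonoidHom.id (absoluteGaloisGroup E₂))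
    (Y₂ := DiscreteGaloisModule.toTopRep (ContinuousRep.restrict (mu E₁ N)
        (β.symm : absoluteGaloisGroup E₂ →ₜ* absoluteGaloisGroup E₁)))
    (Y₃ := (mu E₂ N).toTopRep)
    (layerCoeff L₁ H₁ hH₁ res₁ res_smul₁ E₁ hHE₁ m₁) (layerCoeff L₂ H₂ hH₂ res₂ res_smul₂ E₂ hHE₂ m₂)
    (TopRep.ofHom ⟨ContinuousLinearMap.id ℤ (MuCarrier E₁ N), fun _ => rfl⟩)
    (TopRep.ofHom ⟨(Prop121vii.intertwiningOfEquivariant β (mu E₁ N) (mu E₂ N)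
        (Prop121vii.muCarrierMap ψ N) hμ).toContinuousLinearMap,
      (Prop121vii.intertwiningOfEquivariant β (mu E₁ N) (mu E₂ N)
        (Prop121vii.muCarrierMap ψ N) hμ).isIntertwining'⟩)
    (by
      refine ContinuousMonoidHom.ext fun τ => Subtype.ext ?_
      change e.isoG.symm (absGaloisRestrict K₂ E₂ τ) = absGaloisRestrict K₁ E₁ (β.symm τ)
      apply e.isoG.injective
      rw [ContinuousMulEquiv.apply_symm_apply, ← hβ, ContinuousMulEquiv.apply_symm_apply])
    (fun ζ => by
      change layerMuEquiv E₂ N (m₂.toContinuousLinearEquiv ((e.muAddLinearEquiv N).symm ζ)) =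
        Prop121vii.muCarrierMap ψ N (layerMuEquiv E₁ N (m₁.toContinuousLinearEquiv ζ))
      rw [Iso.muAddLinearEquiv_symm_apply]
      exact hψ ζ)
  have h := congrArg (fun φ => (TopModuleCat.Hom.hom φ) (fnToH2Of (ofGalois L₁ H₁ hH₁ res₁ res_smul₁) N x)) key
  simp only [TopModuleCat.hom_comp, ContinuousLinearMap.coe_comp, Function.comp_apply] at h
  exact h

/-- **The `μ`-square hypothesis `hψ` of `fnLayerMap_isoFN` from its `K̄`-level form** (the shape PIECE A
delivers): if `ψ : Ē₁ˣ → Ē₂ˣ` EXTENDS a map `ψ̄ : K̄₁ˣ → K̄₂ˣ` along the chosen embeddings `K̄ᵢ → Ēᵢ`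
(`hA`, abc-iut-w5-d201's `Prop121vii.exists_layerTransport`) and `ψ̄` restricted to `μ_N` IS `e.muIso`
through the models `mᵢ : μ_N(Aᵢ) ≅ μ_N(K̄ᵢ)` (`hO`, "`Ψ` preserves `O^⊳(−)`" read on roots of unity),
then the `μ`-square for `layerMuEquiv` holds. [cite: MochizukiFrdII2008, Thm 2.4 (ii) p.21] -/
theorem layerMuEquiv_square_of_units (ψbar : (AlgebraicClosure K₁)ˣ → (AlgebraicClosure K₂)ˣ)
    (hA : ∀ x : (AlgebraicClosure K₁)ˣ,
      ψ (Units.map (absClosureEmbedding K₁ E₁ : AlgebraicClosure K₁ →+* AlgebraicClosure E₁).toMonoidHom x) =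
        Units.map (absClosureEmbedding K₂ E₂ : AlgebraicClosure K₂ →+* AlgebraicClosure E₂).toMonoidHom
          (ψbar x))
    (hO : ∀ ζ : Mu N O₁,
      ((m₂.toMulEquiv (e.muIso N ζ) : rootsOfUnity N (AlgebraicClosure K₂)) : (AlgebraicClosure K₂)ˣ) =
        ψbar ((m₁.toMulEquiv ζ : rootsOfUnity N (AlgebraicClosure K₁)) : (AlgebraicClosure K₁)ˣ))
    (ζ : Additive (Mu N O₁)) :
    layerMuEquiv E₂ N (m₂.toContinuousLinearEquiv (Additive.ofMul (e.muIso N (Additive.toMul ζ)))) =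
      Prop121vii.muCarrierMap ψ N (layerMuEquiv E₁ N (m₁.toContinuousLinearEquiv ζ)) := by
  apply (MuCarrier.toAdditive (K := E₂) (n := N)).injective
  apply Additive.toMul.injective
  refine Subtype.ext ?_
  -- left side: the embedding of `m₂ (muIso ζ)`; right side: `ψ` of the embedding of `m₁ ζ`
  rw [MuModel.toContinuousLinearEquiv_apply, MuModel.toContinuousLinearEquiv_apply, toMul_ofMul]
  change ((MulEquiv.restrictRootsOfUnity (absClosureEquiv K₂ E₂).toRingEquiv.toMulEquiv N
      (m₂.toMulEquiv (e.muIso N (Additive.toMul ζ))) : rootsOfUnity N (AlgebraicClosure E₂)) :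
        (AlgebraicClosure E₂)ˣ) =
    ψ ((MulEquiv.restrictRootsOfUnity (absClosureEquiv K₁ E₁).toRingEquiv.toMulEquiv N
      (m₁.toMulEquiv (Additive.toMul ζ)) : rootsOfUnity N (AlgebraicClosure E₁)) : (AlgebraicClosure E₁)ˣ)
  have h1 : ((MulEquiv.restrictRootsOfUnity (absClosureEquiv K₁ E₁).toRingEquiv.toMulEquiv N
      (m₁.toMulEquiv (Additive.toMul ζ)) : rootsOfUnity N (AlgebraicClosure E₁)) : (AlgebraicClosure E₁)ˣ) =
      Units.map (absClosureEmbedding K₁ E₁ : AlgebraicClosure K₁ →+* AlgebraicClosure E₁).toMonoidHom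
        ((m₁.toMulEquiv (Additive.toMul ζ) : rootsOfUnity N (AlgebraicClosure K₁)) : (AlgebraicClosure K₁)ˣ) :=
    Units.ext rfl
  have h2 : ((MulEquiv.restrictRootsOfUnity (absClosureEquiv K₂ E₂).toRingEquiv.toMulEquiv N
      (m₂.toMulEquiv (e.muIso N (Additive.toMul ζ))) : rootsOfUnity N (AlgebraicClosure E₂)) :
        (AlgebraicClosure E₂)ˣ) =
      Units.map (absClosureEmbedding K₂ E₂ : AlgebraicClosure K₂ →+* AlgebraicClosure E₂).toMonoidHom
        ((m₂.toMulEquiv (e.muIso N (Additive.toMul ζ)) : rootsOfUnity N (AlgebraicClosure K₂)) :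
          (AlgebraicClosure K₂)ˣ) :=
    Units.ext rfl
  rw [h1, h2, hA, hO]

end Naturality

end Def22Context

end PadicKummer

end Literature.AlgebraicGeometry.Frobenioids

end
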